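/-
Copyright (c) 2026 the pub-hodgecm-mathlib formalisation cell (harness21).  Prover seat hodgecm-mathlib-F0P3a-p03 (g20): line LH7 (closer row `stub_PKtupleK2`, #181 III-127;
h413 = stmt-HodgeConjecture-24833), leaf ED. 3 road, O8b census §1 — the first in-house bite of the ISOTYPY letter (O8b♭); 2026-09-02.
-/
import Summits.HodgeConjecture.HodgeConjecture.Theorems.F0P3cPKtupleU1Line                 -- ★ (γ′): `xiLocalChar_comp_inl_comp_localPiEquiv`, `comap_mk_ofChar`, `isOpen_ker_comp_equiv`, `isOpen_ker_xiLocalChar_comp_inl` (+ ★ (β) `Realises₂`, ★ `cmDetChar`)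
import Literature.NumberTheory.Automorphic.SmoothRepUniqueConstituentCompact                 -- ★ p850220 (this seat): `IrrClass.apply_eq_smul_of_forall_isConstituentOf_eq_mk_ofChar`
import Literature.NumberTheory.Automorphic.UnitaryGroupPlaceInclusion                        -- ★ `inclPlace`, `continuous_inclPlace`, `inclPlaceAdelic`
import HarnessLib

/-!
# LH7 leaf ED. 3, (O8b♭) first bite — `Realises₂ P₂ ξ` ⇒ at every finite place every COMPACT subgroup of `U(Φ₂)(L⁺_v)` acts on the finite-adelic smooth vectors of `P₂`
# through the character `((η ψ) ∘ det) ∘ ι_v` ([Rogawski1990] §13.3 p. 203; [BushnellHenniart2006] §2.3)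

Cell `pub/hodgecm-mathlib` (D-0151), crux H413 = `stmt-HodgeConjecture-24833`, half A line LH7, banked leaf ED. 3 road (LH7-plan (g2) `MEMO-ED3.v2` §7 (c); this seat's census
`F0/P3a/F0P3a-p03/g20/CENSUS-O8b-PKmultOneU2.F0P3ap03g20.md`).  THEOREMS ONLY (kernel lane; no `def`, no instance, no notation, no named fact, no `sorry`).
THE CENSUS SPLIT O8b = (O8b♯) LINE UNIQUENESS [★ p850105∕p850173] + (O8b♭) ISOTYPY «`Realises₂ P₂ ξ ⇒ U(Φ₂)(𝔸)` acts on `P₂` by `(η ψ)(det g)`» [PRINT].  THIS FILE proves the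
COMPACT-SUBGROUP part of (O8b♭) at the finite places: `Realises₂ P₂ ξ` says the constituents of `V_v := P₂^∞|_{U(Φ₂)(L⁺_v)}` (`P₂.finRep.smoothPart ∘ inclPlace v`) are EXACTLY
`{⟦ℂ_{χ_v}⟧}` with `χ_v = ((η ψ) ∘ det) ∘ ι_v` (★ `xiLocalChar_comp_inl_comp_localPiEquiv`), so ★ p850220 `IrrClass.apply_eq_smul_of_forall_isConstituentOf_eq_mk_ofChar` makes every
subgroup `K ≤ U(Φ₂)(L⁺_v)` contained in a compact set act on `V_v` through `χ_v`.
* §1 `forall_isConstituentOf_iff_of_realises₂` — the constituents of `P₂.finRep.smoothPart ∘ inclPlace v` in the `localPi` currency: `c₀` is one iff `c₀ = ⟦ℂ_{χ_v}⟧`;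
* §2 **`finRep_inclPlace_apply_eq_smul_of_realises₂`** — for `K ≤ U(Φ₂)(L⁺_v)` with `IsCompact ↑K`, `k ∈ K` and a `U(Φ₂)(𝔸_f)`-smooth `f ∈ P₂`:
  `P₂.finRep (inclPlace v k) f = (η ψ)(det (ι_v k)) • f`; `toContRep_inclPlaceAdelic_apply_eq_smul_of_realises₂` (the same on `P₂.space.toContRep (ι_v k)`).
WHAT REMAINS of (O8b♭) after this file (honest): (a) from the compact subgroups to all of `U(Φ₂)(L⁺_v)` — group generation at the non-split places, UNITARITY at the split places
(`GL₂(L_w) ∕ GL₂(L_w)° ≅ ℤ`); (b) from the places to `U(Φ₂)(𝔸_f)` (restricted-product generation + a.e. unramifiedness of `(η ψ) ∘ det`); (c) the archimedean component (weak approximation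
for `U(Φ₂)` at `∞`).  HONEST LABEL: count-neutral; HC_CM is proved only modulo the 7 printed citations (2 remaining: hLiu418 = stmt-HodgeConjecture-24832, h413 = stmt-HodgeConjecture-24833)
until rung 0 closes.

## References
* [Rogawski1990] J. D. Rogawski, *Automorphic Representations of Unitary Groups in Three Variables* (1990), §13.3 pp. 202–203 (`m(ξ) = 1`), §12.2 pp. 173–174.
* [BushnellHenniart2006] C. J. Bushnell, G. Henniart, *The local Langlands conjecture for GL(2)* (2006), §2.3 Lemma (`V = V^K ⊕ V(K)`), §9.1.
* [BernsteinZelevinsky1976] I. N. Bernstein, A. V. Zelevinsky, Russian Math. Surveys 31:3 (1976), §2.1–§2.3.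
-/

set_option autoImplicit false
-- the mandated namespace repeats the single-problem summit's segment (`HodgeConjecture.HodgeConjecture`)
set_option linter.dupNamespace false

noncomputable section

namespace Summit.HodgeConjecture.HodgeConjecture.Cruxes.H413.F0P3cPKtupleU2LocalIsotypyCompact

open MeasureTheory NumberField IsDedekindDomain
open Literature.NumberTheory Literature.NumberTheory.Automorphic Literature.NumberTheory.Automorphic.UnitaryGroup
open Literature.NumberTheory.Rogawski1990 Literature.NumberTheory.GaloisRepresentations
open Literature.NumberTheory.Automorphic.Arthur2013.Leaves.TECR
open Summit.HodgeConjecture.HodgeConjecture.Cruxes.H413.F0P3GlobalPacketDiscrete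
open Summit.HodgeConjecture.HodgeConjecture.Cruxes.H413.F0P3cPKtupleHSideLetters
open Summit.HodgeConjecture.HodgeConjecture.Cruxes.H413.F0P3cPKtupleU1Line

variable {L : Type} [Field L] [NumberField L] [IsCMField L]

/-! ## §1 The constituents of `P₂^∞|_{U(Φ₂)(L⁺_v)}` under `Realises₂`, in the `localPi` currency -/

/-- **Under `Realises₂ P₂ ξ`, the constituents of `P₂.finRep.smoothPart ∘ inclPlace v` are exactly `{⟦ℂ_{χ_v}⟧}`, `χ_v = ((η ψ) ∘ det) ∘ ι_v`** (classes of the Π-model group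
`localPi … v`): ★ `Realises₂` speaks of the `cmDatum`-model classes transported along ★ `localPiEquiv v`; ★ `IrrClass.comap_comap_symm` and ★ `comap_mk_ofChar` ∕ ★
`xiLocalChar_comp_inl_comp_localPiEquiv` translate. [cite: Rogawski1990, §13.3 pp. 202–203; §12.2 pp. 173–174] -/
theorem isConstituentOf_iff_of_realises₂
    {μ₂ : Measure (adelicGroupData ↥(maximalRealSubfield L) L (IsCMField.complexConj L) 2 (Matrix.of fun i j : Fin 2 => if i.val + j.val + 1 = 2 then (1 : L) else 0)).automorphicQuotient}
    [(adelicGroupData ↥(maximalRealSubfield L) L (IsCMField.complexConj L) 2 (Matrix.of fun i j : Fin 2 => if i.val + j.val + 1 = 2 then (1 : L) else 0)).IsAutomorphicMeasure μ₂]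
    (P₂ : DiscreteAutomorphicRep (adelicGroupData ↥(maximalRealSubfield L) L (IsCMField.complexConj L) 2 (Matrix.of fun i j : Fin 2 => if i.val + j.val + 1 = 2 then (1 : L) else 0)) μ₂) (ξ : OneDimAutRepH L)
    (h : Realises₂ P₂ ξ) (v : HeightOneSpectrum (𝓞 ↥(maximalRealSubfield L)))
    (c₀ : IrrClass ↥(localPi L (IsCMField.complexConj L) 2 (Matrix.of fun i j : Fin 2 => if i.val + j.val + 1 = 2 then (1 : L) else 0) v)) :
    c₀.IsConstituentOf (P₂.finRep.smoothPart.toRepresentation.comp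
        (inclPlace ↥(maximalRealSubfield L) L (IsCMField.complexConj L) 2 (Matrix.of fun i j : Fin 2 => if i.val + j.val + 1 = 2 then (1 : L) else 0) v)) ↔
      c₀ = IrrClass.mk (SmoothIrrep.ofChar
        ((cmDetChar L 2 (Matrix.of fun i j : Fin 2 => if i.val + j.val + 1 = 2 then (1 : L) else 0) (ξ.η * ξ.ψ) (isAutomorphic_eta_mul_psi ξ) (isUnit_antidiagOne_det L 2).ne_zero).toMonoidHom.comp
          (inclPlaceAdelic ↥(maximalRealSubfield L) L (IsCMField.complexConj L) 2 (Matrix.of fun i j : Fin 2 => if i.val + j.val + 1 = 2 then (1 : L) else 0) v))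
        (isOpen_ker_comp_inclPlaceAdelic
          (cmDetChar L 2 (Matrix.of fun i j : Fin 2 => if i.val + j.val + 1 = 2 then (1 : L) else 0) (ξ.η * ξ.ψ) (isAutomorphic_eta_mul_psi ξ) (isUnit_antidiagOne_det L 2).ne_zero).toMonoidHom
          (cmDetChar L 2 (Matrix.of fun i j : Fin 2 => if i.val + j.val + 1 = 2 then (1 : L) else 0) (ξ.η * ξ.ψ) (isAutomorphic_eta_mul_psi ξ) (isUnit_antidiagOne_det L 2).ne_zero).continuous v)) := by
  -- the class of `χ_v` in the Π-model is the transport of the class of `ξ_v ∘ inl`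
  have hcl : IrrClass.mk (SmoothIrrep.ofChar
        ((cmDetChar L 2 (Matrix.of fun i j : Fin 2 => if i.val + j.val + 1 = 2 then (1 : L) else 0) (ξ.η * ξ.ψ) (isAutomorphic_eta_mul_psi ξ) (isUnit_antidiagOne_det L 2).ne_zero).toMonoidHom.comp
          (inclPlaceAdelic ↥(maximalRealSubfield L) L (IsCMField.complexConj L) 2 (Matrix.of fun i j : Fin 2 => if i.val + j.val + 1 = 2 then (1 : L) else 0) v))
        (isOpen_ker_comp_inclPlaceAdelic
          (cmDetChar L 2 (Matrix.of fun i j : Fin 2 => if i.val + j.val + 1 = 2 then (1 : L) else 0) (ξ.η * ξ.ψ) (isAutomorphic_eta_mul_psi ξ) (isUnit_antidiagOne_det L 2).ne_zero).toMonoidHom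
          (cmDetChar L 2 (Matrix.of fun i j : Fin 2 => if i.val + j.val + 1 = 2 then (1 : L) else 0) (ξ.η * ξ.ψ) (isAutomorphic_eta_mul_psi ξ) (isUnit_antidiagOne_det L 2).ne_zero).continuous v)) =
      IrrClass.comap (localPiEquiv L (IsCMField.complexConj L) 2 (Matrix.of fun i j : Fin 2 => if i.val + j.val + 1 = 2 then (1 : L) else 0) v)
        (IrrClass.mk (SmoothIrrep.ofChar ((ξ.xiLocalChar v).comp (MonoidHom.inl ((cmDatum L 2 (Matrix.of fun i j : Fin 2 => if i.val + j.val + 1 = 2 then (1 : L) else 0)).Local v) ((cmDatum L 1 (Matrix.of fun i j : Fin 1 => if i.val + j.val + 1 = 1 then (1 : L) else 0)).Local v)))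
          ((F0P3XiLocalCharOpenKernel.isOpen_ker_xiLocalChar L ξ v).preimage (Continuous.prodMk_left 1)))) :=
    ((IrrClass.mk_ofChar_eq_mk_ofChar_iff
          (isOpen_ker_comp_inclPlaceAdelic
            (cmDetChar L 2 (Matrix.of fun i j : Fin 2 => if i.val + j.val + 1 = 2 then (1 : L) else 0) (ξ.η * ξ.ψ) (isAutomorphic_eta_mul_psi ξ) (isUnit_antidiagOne_det L 2).ne_zero).toMonoidHom
            (cmDetChar L 2 (Matrix.of fun i j : Fin 2 => if i.val + j.val + 1 = 2 then (1 : L) else 0) (ξ.η * ξ.ψ) (isAutomorphic_eta_mul_psi ξ) (isUnit_antidiagOne_det L 2).ne_zero).continuous v)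
          (isOpen_ker_comp_equiv (localPiEquiv L (IsCMField.complexConj L) 2 (Matrix.of fun i j : Fin 2 => if i.val + j.val + 1 = 2 then (1 : L) else 0) v) _ (isOpen_ker_xiLocalChar_comp_inl ξ v))).2
        (xiLocalChar_comp_inl_comp_localPiEquiv ξ v).symm).trans
      (comap_mk_ofChar (localPiEquiv L (IsCMField.complexConj L) 2 (Matrix.of fun i j : Fin 2 => if i.val + j.val + 1 = 2 then (1 : L) else 0) v)
        ((ξ.xiLocalChar v).comp (MonoidHom.inl ((cmDatum L 2 (Matrix.of fun i j : Fin 2 => if i.val + j.val + 1 = 2 then (1 : L) else 0)).Local v) ((cmDatum L 1 (Matrix.of fun i j : Fin 1 => if i.val + j.val + 1 = 1 then (1 : L) else 0)).Local v)))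
        (isOpen_ker_xiLocalChar_comp_inl ξ v) _).symm
  rw [hcl, ← IrrClass.comap_comap_symm (localPiEquiv L (IsCMField.complexConj L) 2 (Matrix.of fun i j : Fin 2 => if i.val + j.val + 1 = 2 then (1 : L) else 0) v) c₀]
  exact (h v _).trans (IrrClass.comap_injective _).eq_iff.symm

/-! ## §2 Compact subgroups of `U(Φ₂)(L⁺_v)` act on the finite-adelic smooth vectors of `P₂` through `((η ψ) ∘ det) ∘ ι_v` -/

/-- **`Realises₂ P₂ ξ` ⇒ COMPACT-SUBGROUP ISOTYPY AT `v`**: for every finite place `v`, every subgroup `K ≤ U(Φ₂)(L⁺_v)` (Π-model ★ `localPi … v`) contained in a compact set, every `k ∈ K`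
and every `U(Φ₂)(𝔸_f)`-smooth vector `f` of `P₂` (★ `finRep.smoothPart`): `P₂.finRep (inclPlace v k) f = (η ψ)(det (ι_v k)) • f` — ★ p850220 applied to the smooth `U(Φ₂)(L⁺_v)`-representation
`P₂.finRep.smoothPart ∘ inclPlace v` (★ `isSmooth_smoothPart`, ★ `IsSmooth.comp`, ★ `continuous_inclPlace`), whose constituents §1 identifies.  The compact-subgroup part of the
ISOTYPY letter (O8b♭) of the O8b census; nothing is claimed for non-compact subgroups. [cite: Rogawski1990, §13.3 p. 203] [cite: BushnellHenniart2006, §2.3 Lemma; §9.1]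
[cite: BernsteinZelevinsky1976, §2.1–§2.3] -/
theorem finRep_smoothPart_inclPlace_apply_eq_smul_of_realises₂
    {μ₂ : Measure (adelicGroupData ↥(maximalRealSubfield L) L (IsCMField.complexConj L) 2 (Matrix.of fun i j : Fin 2 => if i.val + j.val + 1 = 2 then (1 : L) else 0)).automorphicQuotient}
    [(adelicGroupData ↥(maximalRealSubfield L) L (IsCMField.complexConj L) 2 (Matrix.of fun i j : Fin 2 => if i.val + j.val + 1 = 2 then (1 : L) else 0)).IsAutomorphicMeasure μ₂]
    (P₂ : DiscreteAutomorphicRep (adelicGroupData ↥(maximalRealSubfield L) L (IsCMField.complexConj L) 2 (Matrix.of fun i j : Fin 2 => if i.val + j.val + 1 = 2 then (1 : L) else 0)) μ₂) (ξ : OneDimAutRepH L)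
    (h : Realises₂ P₂ ξ) (v : HeightOneSpectrum (𝓞 ↥(maximalRealSubfield L)))
    (K : Subgroup ↥(localPi L (IsCMField.complexConj L) 2 (Matrix.of fun i j : Fin 2 => if i.val + j.val + 1 = 2 then (1 : L) else 0) v))
    (hK : IsCompact (K : Set ↥(localPi L (IsCMField.complexConj L) 2 (Matrix.of fun i j : Fin 2 => if i.val + j.val + 1 = 2 then (1 : L) else 0) v)))
    {k : ↥(localPi L (IsCMField.complexConj L) 2 (Matrix.of fun i j : Fin 2 => if i.val + j.val + 1 = 2 then (1 : L) else 0) v)} (hk : k ∈ K)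
    (f : ↥P₂.finRep.smoothPart.toSubmodule) :
    P₂.finRep.smoothPart.toRepresentation (inclPlace ↥(maximalRealSubfield L) L (IsCMField.complexConj L) 2 (Matrix.of fun i j : Fin 2 => if i.val + j.val + 1 = 2 then (1 : L) else 0) v k) f =
      (((cmDetChar L 2 (Matrix.of fun i j : Fin 2 => if i.val + j.val + 1 = 2 then (1 : L) else 0) (ξ.η * ξ.ψ) (isAutomorphic_eta_mul_psi ξ) (isUnit_antidiagOne_det L 2).ne_zero)
        (inclPlaceAdelic ↥(maximalRealSubfield L) L (IsCMField.complexConj L) 2 (Matrix.of fun i j : Fin 2 => if i.val + j.val + 1 = 2 then (1 : L) else 0) v k) : ℂˣ) : ℂ) • f :=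
  IrrClass.apply_eq_smul_of_forall_isConstituentOf_eq_mk_ofChar
    (P₂.finRep.smoothPart.toRepresentation.comp (inclPlace ↥(maximalRealSubfield L) L (IsCMField.complexConj L) 2 (Matrix.of fun i j : Fin 2 => if i.val + j.val + 1 = 2 then (1 : L) else 0) v))
    (P₂.finRep.isSmooth_smoothPart.comp _ (continuous_inclPlace ↥(maximalRealSubfield L) L (IsCMField.complexConj L) 2 (Matrix.of fun i j : Fin 2 => if i.val + j.val + 1 = 2 then (1 : L) else 0) v))
    _ _ (fun c₀ hc₀ => (isConstituentOf_iff_of_realises₂ P₂ ξ h v c₀).1 hc₀) K hK hk f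

/-- **The same on the underlying `L²` vectors**: for `k ∈ K ≤ U(Φ₂)(L⁺_v)` compact and `f` a `U(Φ₂)(𝔸_f)`-smooth vector of `P₂`, `R(ι_v k) f = (η ψ)(det (ι_v k)) • f` in
`L²(U(Φ₂)(L⁺) \ U(Φ₂)(𝔸))` (`P₂.finRep g = P₂.space.toContRep (finAdelicToAdelic g)`, ★ `inclPlaceAdelic v = finAdelicToAdelic ∘ inclPlace v`, both `rfl`).
[cite: Rogawski1990, §13.3 p. 203] [cite: BushnellHenniart2006, §2.3 Lemma] -/
theorem toContRep_inclPlaceAdelic_apply_eq_smul_of_realises₂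
    {μ₂ : Measure (adelicGroupData ↥(maximalRealSubfield L) L (IsCMField.complexConj L) 2 (Matrix.of fun i j : Fin 2 => if i.val + j.val + 1 = 2 then (1 : L) else 0)).automorphicQuotient}
    [(adelicGroupData ↥(maximalRealSubfield L) L (IsCMField.complexConj L) 2 (Matrix.of fun i j : Fin 2 => if i.val + j.val + 1 = 2 then (1 : L) else 0)).IsAutomorphicMeasure μ₂]
    (P₂ : DiscreteAutomorphicRep (adelicGroupData ↥(maximalRealSubfield L) L (IsCMField.complexConj L) 2 (Matrix.of fun i j : Fin 2 => if i.val + j.val + 1 = 2 then (1 : L) else 0)) μ₂) (ξ : OneDimAutRepH L)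
    (h : Realises₂ P₂ ξ) (v : HeightOneSpectrum (𝓞 ↥(maximalRealSubfield L)))
    (K : Subgroup ↥(localPi L (IsCMField.complexConj L) 2 (Matrix.of fun i j : Fin 2 => if i.val + j.val + 1 = 2 then (1 : L) else 0) v))
    (hK : IsCompact (K : Set ↥(localPi L (IsCMField.complexConj L) 2 (Matrix.of fun i j : Fin 2 => if i.val + j.val + 1 = 2 then (1 : L) else 0) v)))
    {k : ↥(localPi L (IsCMField.complexConj L) 2 (Matrix.of fun i j : Fin 2 => if i.val + j.val + 1 = 2 then (1 : L) else 0) v)} (hk : k ∈ K)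
    (f : ↥P₂.space.toSubmodule) (hf : f ∈ P₂.finRep.smoothPart) :
    P₂.space.toContRep (inclPlaceAdelic ↥(maximalRealSubfield L) L (IsCMField.complexConj L) 2 (Matrix.of fun i j : Fin 2 => if i.val + j.val + 1 = 2 then (1 : L) else 0) v k) f =
      (((cmDetChar L 2 (Matrix.of fun i j : Fin 2 => if i.val + j.val + 1 = 2 then (1 : L) else 0) (ξ.η * ξ.ψ) (isAutomorphic_eta_mul_psi ξ) (isUnit_antidiagOne_det L 2).ne_zero)
        (inclPlaceAdelic ↥(maximalRealSubfield L) L (IsCMField.complexConj L) 2 (Matrix.of fun i j : Fin 2 => if i.val + j.val + 1 = 2 then (1 : L) else 0) v k) : ℂˣ) : ℂ) • f :=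
  congrArg Subtype.val (finRep_smoothPart_inclPlace_apply_eq_smul_of_realises₂ P₂ ξ h v K hK hk ⟨f, hf⟩)

end Summit.HodgeConjecture.HodgeConjecture.Cruxes.H413.F0P3cPKtupleU2LocalIsotypyCompact

end
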